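import Summits.PneNP.PneNP.Theorems.ConvexRankGatesCliqueExtLowerBoundConvCalibrationR6

/-!
# The DNF side of a sandwich is idle: CNF-side-only forms of the three r6 stubs (reshape r7)
(crux `CliqueExtLowerBound`, stmt-PneNP-10682; line `width-threshold-certificate-sparsity`, lead c9)

`Sandwichable r s A P N ε φ` (…WidthThresholdDefs) asks, for every tuple of legal local child pairs
`D j ≤ C j`, for ONE legal local pair `dnf ≤ cnf` that loses at most `ε·#P` of the positives accepted by
`φ ∘ dval D` and accepts at most `ε·#N` of the negatives rejected by `φ ∘ cval C`. Every gate of the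
extended basis is MONOTONE, and `D j ≤ C j` pointwise gives `dval D x ≤ cval C x`, hence
`φ (dval D x) ≤ φ (cval C x)`: a pair that sandwiches the SINGLE function `φ ∘ cval C` on both sides
sandwiches the pair. So the DNF tuple `D` carries no information in any of the three open r6 stubs
(`stub_permSandwichable`, `stub_grankSandwichable`, `stub_convWide`), and each is implied by its
CNF-SIDE-ONLY form (one tuple `C`, two hypotheses fewer, the gate applied to `s`-local monotone CNFs of
the edges on both sides). This file proves:

* `sandwichable_of_cnfSide` — the generic lemma in the `Sandwichable` currency;
* `pairGoal_of_cnfGoal` — the same pointwise, in the stubs' unfolded vocabulary;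
* `permPairText_of_cnfText`, `grankPairText_of_cnfText`, `convWidePairText_of_cnfText` (REGISTERED) — each
  r7 stub text implies the corresponding r6 stub text verbatim (so the landed calibrations p114835 /
  p115659 / p121086 and the barrier certificate p125807 apply to the r7 texts unchanged);
* `cliqueExtLowerBound_of_three_r7` (REGISTERED) — THE r7 BRIDGE: the crux from the three CNF-side texts,
  by `ConvCalibrationR6.cliqueExtLowerBound_of_three_r6`.

The converse direction (r6 text ⇒ r7 text) costs one switching error per distinct child and is not
needed by the line. Lead prover seat `prover-line-stmt-PneNP-10682-c9`, 2026-08-17.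
-/

set_option linter.dupNamespace false

open Literature.Computability.Complexity Filter Finset
open Summit.PneNP.PneNP.Theorems.CliqueExtLowerBound.WidthThreshold

noncomputable section

namespace Summit.PneNP.PneNP.Theorems.CliqueExtLowerBound.WidthThreshold.CnfSide

/-! ## §1 The generic lemma -/

section Generic

variable {ι : Type}

open Classical in
/-- Legal children are ordered: `D j ≤ C j` for all `j` gives `dval D x ≤ cval C x`. [folklore] -/
theorem dval_le_cval {n : ℕ} {D C : Fin n → Finset (Finset ι)}
    (hDC : ∀ j x, EvalDNF (D j) x → EvalCNF (C j) x) (x : ι → Bool) : dval D x ≤ cval C x := by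
  intro j
  show decide (EvalDNF (D j) x) ≤ decide (EvalCNF (C j) x)
  rw [Bool.le_iff_imp, decide_eq_true_eq, decide_eq_true_eq]
  exact hDC j x

open Classical in
/-- For a monotone gate, the positives accepted through the DNF children are among those accepted
through the CNF children, so the positive error of any `dnf` only grows when `dval D` is replaced by
`cval C`. [folklore] -/
theorem card_filter_dval_le_card_filter_cval (φ : GateFn) (hφ : Monotone φ.2) (P : Finset (ι → Bool))
    {D C : Fin φ.1 → Finset (Finset ι)} (hDC : ∀ j x, EvalDNF (D j) x → EvalCNF (C j) x)
    (dnf : Finset (Finset ι)) :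
    #(P.filter fun x => φ.2 (dval D x) = true ∧ ¬ EvalDNF dnf x) ≤
      #(P.filter fun x => φ.2 (cval C x) = true ∧ ¬ EvalDNF dnf x) := by
  refine card_le_card fun x hx => ?_
  simp only [mem_filter] at hx ⊢
  exact ⟨hx.1, eq_true_of_le_of_eq_true (hφ (dval_le_cval hDC x)) hx.2.1, hx.2.2⟩

/-- The number of distinct CNF children is at most the number of distinct child pairs. [folklore] -/
theorem card_image_cnf_le [DecidableEq ι] {n : ℕ} (D C : Fin n → Finset (Finset ι)) :
    #(univ.image C) ≤ #(univ.image fun j => (D j, C j)) := by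
  have : (univ.image C) = (univ.image fun j => (D j, C j)).image Prod.snd := by
    rw [image_image]; rfl
  rw [this]
  exact card_image_le

open Classical in
/-- **The DNF side is idle (REGISTERED `sandwichable_of_cnfSide`).** A monotone gate `φ` is
`(r,s)`-sandwichable on `(P, N)` with error `ε` for children from `≤ A` distinct pairs as soon as, for
every tuple `C` of `s`-local CNF children with `≤ A` distinct members, some legal local pair
`dnf ≤ cnf` sandwiches the single function `φ ∘ cval C`: it loses `≤ ε·#P` of the positives accepted by
`φ ∘ cval C` and accepts `≤ ε·#N` of the negatives rejected by it. [folklore] -/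
theorem sandwichable_of_cnfSide : ∀ (ι : Type) [DecidableEq ι] (r s A : ℕ) (P N : Finset (ι → Bool))
    (ε : ℝ) (φ : GateFn), Monotone φ.2 →
    (∀ C : Fin φ.1 → Finset (Finset ι), #(univ.image C) ≤ A → (∀ j, ∀ S ∈ C j, #S ≤ s - 1) →
      ∃ dnf cnf : Finset (Finset ι), (∀ R ∈ dnf, #R ≤ r - 1) ∧ (∀ S ∈ cnf, #S ≤ s - 1) ∧
        (∀ x, EvalDNF dnf x → EvalCNF cnf x) ∧
        (#(P.filter fun x => φ.2 (fun j => decide (EvalCNF (C j) x)) = true ∧ ¬ EvalDNF dnf x) : ℝ)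
          ≤ ε * #P ∧
        (#(N.filter fun x => EvalCNF cnf x ∧ φ.2 (fun j => decide (EvalCNF (C j) x)) = false) : ℝ)
          ≤ ε * #N) →
    Sandwichable r s A P N ε φ := by
  intro ι _ r s A P N ε φ hφ h D C hA _hD hC hDC
  obtain ⟨dnf, cnf, h1, h2, h3, h4, h5⟩ := h C ((card_image_cnf_le D C).trans hA) hC
  refine ⟨dnf, cnf, h1, h2, h3, le_trans ?_ h4, h5⟩
  exact_mod_cast card_filter_dval_le_card_filter_cval φ hφ P hDC dnf

end Generic

/-! ## §2 Pointwise form in the stubs' vocabulary -/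

open Classical in
/-- Pointwise version over the edge slots of `K_m`: a CNF-side conclusion for the children `C` is a
pair conclusion for every legal `(D, C)`. [folklore] -/
theorem pairGoal_of_cnfGoal {m : ℕ} (φ : GateFn) (hφ : Monotone φ.2) {r s : ℕ} {ε : ℝ}
    (P N : Finset (EV m → Bool)) {D C : Fin φ.1 → Finset (Finset (EV m))}
    (hDC : ∀ j x, EvalDNF (D j) x → EvalCNF (C j) x)
    (h : ∃ dnf cnf : Finset (Finset (EV m)), (∀ R ∈ dnf, #R ≤ r - 1) ∧ (∀ S ∈ cnf, #S ≤ s - 1) ∧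
        (∀ x, EvalDNF dnf x → EvalCNF cnf x) ∧
        (#(P.filter fun x => φ.2 (fun j => decide (EvalCNF (C j) x)) = true ∧ ¬ EvalDNF dnf x) : ℝ)
          ≤ ε * #P ∧
        (#(N.filter fun x => EvalCNF cnf x ∧ φ.2 (fun j => decide (EvalCNF (C j) x)) = false) : ℝ)
          ≤ ε * #N) :
    ∃ dnf cnf : Finset (Finset (EV m)), (∀ R ∈ dnf, #R ≤ r - 1) ∧ (∀ S ∈ cnf, #S ≤ s - 1) ∧
        (∀ x, EvalDNF dnf x → EvalCNF cnf x) ∧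
        (#(P.filter fun x => φ.2 (fun j => decide (EvalDNF (D j) x)) = true ∧ ¬ EvalDNF dnf x) : ℝ)
          ≤ ε * #P ∧
        (#(N.filter fun x => EvalCNF cnf x ∧ φ.2 (fun j => decide (EvalCNF (C j) x)) = false) : ℝ)
          ≤ ε * #N := by
  obtain ⟨dnf, cnf, h1, h2, h3, h4, h5⟩ := h
  refine ⟨dnf, cnf, h1, h2, h3, le_trans ?_ h4, h5⟩
  exact_mod_cast card_filter_dval_le_card_filter_cval φ hφ P hDC dnf

/-! ## §3 The three r7 stub texts imply the r6 stub texts (REGISTERED), and the r7 bridge -/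

open Classical in
/-- **PERM (REGISTERED `permPairText_of_cnfText`)**: the CNF-side r7 text `stub_permCnf` implies the r6 text
`stub_permSandwichable` verbatim; in particular the r7 text inherits the calibration p114835 (no poly-dimension
permutation-group membership program for `CLIQUE(m, ⌈m^{1/4}⌉₊)`). [folklore] -/
theorem permPairText_of_cnfText :
    (∀ c : ℕ, ∃ r₀ s₀ : ℕ, 2 ≤ r₀ ∧ 2 ≤ s₀ ∧ ∀ r s : ℕ, r₀ ≤ r → s₀ ≤ s →
    ∀ᶠ m : ℕ in atTop, ∀ φ : GateFn, IsPermGate (m ^ c) φ →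
      ¬ (IsPermGate ⌊(m : ℝ) ^ (1 / 16 : ℝ)⌋₊ φ ∨ IsGRankGate ⌊(m : ℝ) ^ (1 / 16 : ℝ)⌋₊ φ) →
      ∀ C : Fin φ.1 → Finset (Finset ((⊤ : SimpleGraph (Fin m)).edgeSet)),
        #(univ.image C) ≤ m ^ (c + 3) → (∀ j, ∀ S ∈ C j, #S ≤ s - 1) →
        ∃ dnf cnf : Finset (Finset ((⊤ : SimpleGraph (Fin m)).edgeSet)),
          (∀ R ∈ dnf, #R ≤ r - 1) ∧ (∀ S ∈ cnf, #S ≤ s - 1) ∧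
          (∀ x, EvalDNF dnf x → EvalCNF cnf x) ∧
          (#((posGraphs m ⌈(m : ℝ) ^ (1 / 4 : ℝ)⌉₊).filter
              (fun x => φ.2 (fun j => decide (EvalCNF (C j) x)) = true ∧ ¬ EvalDNF dnf x)) : ℝ)
            ≤ (1 / (8 * (m : ℝ) ^ (c + 1))) * #(posGraphs m ⌈(m : ℝ) ^ (1 / 4 : ℝ)⌉₊) ∧
          (#((((powersetCard (Fintype.card ((⊤ : SimpleGraph (Fin m)).edgeSet) / ⌊(m : ℝ) ^ (1 / 8 : ℝ)⌋₊)
          (univ : Finset ((⊤ : SimpleGraph (Fin m)).edgeSet))).image (fun M => fun e => decide (e ∉ M)))).filter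
              (fun x => EvalCNF cnf x ∧ φ.2 (fun j => decide (EvalCNF (C j) x)) = false)) : ℝ)
            ≤ (1 / (8 * (m : ℝ) ^ (c + 1))) *
              #(((powersetCard (Fintype.card ((⊤ : SimpleGraph (Fin m)).edgeSet) / ⌊(m : ℝ) ^ (1 / 8 : ℝ)⌋₊)
          (univ : Finset ((⊤ : SimpleGraph (Fin m)).edgeSet))).image (fun M => fun e => decide (e ∉ M))))) →
    ∀ c : ℕ, ∃ r₀ s₀ : ℕ, 2 ≤ r₀ ∧ 2 ≤ s₀ ∧ ∀ r s : ℕ, r₀ ≤ r → s₀ ≤ s →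
    ∀ᶠ m : ℕ in atTop, ∀ φ : GateFn, IsPermGate (m ^ c) φ →
      ¬ (IsPermGate ⌊(m : ℝ) ^ (1 / 16 : ℝ)⌋₊ φ ∨ IsGRankGate ⌊(m : ℝ) ^ (1 / 16 : ℝ)⌋₊ φ) →
      ∀ (D C : Fin φ.1 → Finset (Finset ((⊤ : SimpleGraph (Fin m)).edgeSet))),
        #(univ.image fun j => (D j, C j)) ≤ m ^ (c + 3) →
        (∀ j, ∀ R ∈ D j, #R ≤ r - 1) → (∀ j, ∀ S ∈ C j, #S ≤ s - 1) →
        (∀ j x, EvalDNF (D j) x → EvalCNF (C j) x) →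
        ∃ dnf cnf : Finset (Finset ((⊤ : SimpleGraph (Fin m)).edgeSet)),
          (∀ R ∈ dnf, #R ≤ r - 1) ∧ (∀ S ∈ cnf, #S ≤ s - 1) ∧
          (∀ x, EvalDNF dnf x → EvalCNF cnf x) ∧
          (#((posGraphs m ⌈(m : ℝ) ^ (1 / 4 : ℝ)⌉₊).filter
              (fun x => φ.2 (fun j => decide (EvalDNF (D j) x)) = true ∧ ¬ EvalDNF dnf x)) : ℝ)
            ≤ (1 / (8 * (m : ℝ) ^ (c + 1))) * #(posGraphs m ⌈(m : ℝ) ^ (1 / 4 : ℝ)⌉₊) ∧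
          (#((((powersetCard (Fintype.card ((⊤ : SimpleGraph (Fin m)).edgeSet) / ⌊(m : ℝ) ^ (1 / 8 : ℝ)⌋₊)
          (univ : Finset ((⊤ : SimpleGraph (Fin m)).edgeSet))).image (fun M => fun e => decide (e ∉ M)))).filter
              (fun x => EvalCNF cnf x ∧ φ.2 (fun j => decide (EvalCNF (C j) x)) = false)) : ℝ)
            ≤ (1 / (8 * (m : ℝ) ^ (c + 1))) *
              #(((powersetCard (Fintype.card ((⊤ : SimpleGraph (Fin m)).edgeSet) / ⌊(m : ℝ) ^ (1 / 8 : ℝ)⌋₊)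
          (univ : Finset ((⊤ : SimpleGraph (Fin m)).edgeSet))).image (fun M => fun e => decide (e ∉ M)))) := by
  intro h7 c
  obtain ⟨r₀, s₀, hr₀, hs₀, h⟩ := h7 c
  refine ⟨r₀, s₀, hr₀, hs₀, fun r s hr hs => ?_⟩
  filter_upwards [h r s hr hs] with m hm φ hφ
  intro hn D C hA _hD hC hDC
  exact pairGoal_of_cnfGoal φ hφ.monotone _ _ hDC (hm φ hφ hn C ((card_image_cnf_le D C).trans hA) hC)

open Classical in
/-- **GRANK (REGISTERED `grankPairText_of_cnfText`)**: the CNF-side r7 text `stub_grankCnf` implies the r6 text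
`stub_grankSandwichable` verbatim; in particular it inherits the calibration p115659 (`¬ HasDetRepr` of the
clique polynomials in size `m^c` over every field — Valiant-hard). [folklore] -/
theorem grankPairText_of_cnfText :
    (∀ c : ℕ, ∃ r₀ s₀ : ℕ, 2 ≤ r₀ ∧ 2 ≤ s₀ ∧ ∀ r s : ℕ, r₀ ≤ r → s₀ ≤ s →
    ∀ᶠ m : ℕ in atTop, ∀ φ : GateFn, IsGRankGate (m ^ c) φ →
      ¬ (IsPermGate ⌊(m : ℝ) ^ (1 / 16 : ℝ)⌋₊ φ ∨ IsGRankGate ⌊(m : ℝ) ^ (1 / 16 : ℝ)⌋₊ φ) →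
      ∀ C : Fin φ.1 → Finset (Finset ((⊤ : SimpleGraph (Fin m)).edgeSet)),
        #(univ.image C) ≤ m ^ (c + 3) → (∀ j, ∀ S ∈ C j, #S ≤ s - 1) →
        ∃ dnf cnf : Finset (Finset ((⊤ : SimpleGraph (Fin m)).edgeSet)),
          (∀ R ∈ dnf, #R ≤ r - 1) ∧ (∀ S ∈ cnf, #S ≤ s - 1) ∧
          (∀ x, EvalDNF dnf x → EvalCNF cnf x) ∧
          (#((posGraphs m ⌈(m : ℝ) ^ (1 / 4 : ℝ)⌉₊).filter
              (fun x => φ.2 (fun j => decide (EvalCNF (C j) x)) = true ∧ ¬ EvalDNF dnf x)) : ℝ)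
            ≤ (1 / (8 * (m : ℝ) ^ (c + 1))) * #(posGraphs m ⌈(m : ℝ) ^ (1 / 4 : ℝ)⌉₊) ∧
          (#((((powersetCard (Fintype.card ((⊤ : SimpleGraph (Fin m)).edgeSet) / ⌊(m : ℝ) ^ (1 / 8 : ℝ)⌋₊)
          (univ : Finset ((⊤ : SimpleGraph (Fin m)).edgeSet))).image (fun M => fun e => decide (e ∉ M)))).filter
              (fun x => EvalCNF cnf x ∧ φ.2 (fun j => decide (EvalCNF (C j) x)) = false)) : ℝ)
            ≤ (1 / (8 * (m : ℝ) ^ (c + 1))) *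
              #(((powersetCard (Fintype.card ((⊤ : SimpleGraph (Fin m)).edgeSet) / ⌊(m : ℝ) ^ (1 / 8 : ℝ)⌋₊)
          (univ : Finset ((⊤ : SimpleGraph (Fin m)).edgeSet))).image (fun M => fun e => decide (e ∉ M))))) →
    ∀ c : ℕ, ∃ r₀ s₀ : ℕ, 2 ≤ r₀ ∧ 2 ≤ s₀ ∧ ∀ r s : ℕ, r₀ ≤ r → s₀ ≤ s →
    ∀ᶠ m : ℕ in atTop, ∀ φ : GateFn, IsGRankGate (m ^ c) φ →
      ¬ (IsPermGate ⌊(m : ℝ) ^ (1 / 16 : ℝ)⌋₊ φ ∨ IsGRankGate ⌊(m : ℝ) ^ (1 / 16 : ℝ)⌋₊ φ) →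
      ∀ (D C : Fin φ.1 → Finset (Finset ((⊤ : SimpleGraph (Fin m)).edgeSet))),
        #(univ.image fun j => (D j, C j)) ≤ m ^ (c + 3) →
        (∀ j, ∀ R ∈ D j, #R ≤ r - 1) → (∀ j, ∀ S ∈ C j, #S ≤ s - 1) →
        (∀ j x, EvalDNF (D j) x → EvalCNF (C j) x) →
        ∃ dnf cnf : Finset (Finset ((⊤ : SimpleGraph (Fin m)).edgeSet)),
          (∀ R ∈ dnf, #R ≤ r - 1) ∧ (∀ S ∈ cnf, #S ≤ s - 1) ∧
          (∀ x, EvalDNF dnf x → EvalCNF cnf x) ∧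
          (#((posGraphs m ⌈(m : ℝ) ^ (1 / 4 : ℝ)⌉₊).filter
              (fun x => φ.2 (fun j => decide (EvalDNF (D j) x)) = true ∧ ¬ EvalDNF dnf x)) : ℝ)
            ≤ (1 / (8 * (m : ℝ) ^ (c + 1))) * #(posGraphs m ⌈(m : ℝ) ^ (1 / 4 : ℝ)⌉₊) ∧
          (#((((powersetCard (Fintype.card ((⊤ : SimpleGraph (Fin m)).edgeSet) / ⌊(m : ℝ) ^ (1 / 8 : ℝ)⌋₊)
          (univ : Finset ((⊤ : SimpleGraph (Fin m)).edgeSet))).image (fun M => fun e => decide (e ∉ M)))).filter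
              (fun x => EvalCNF cnf x ∧ φ.2 (fun j => decide (EvalCNF (C j) x)) = false)) : ℝ)
            ≤ (1 / (8 * (m : ℝ) ^ (c + 1))) *
              #(((powersetCard (Fintype.card ((⊤ : SimpleGraph (Fin m)).edgeSet) / ⌊(m : ℝ) ^ (1 / 8 : ℝ)⌋₊)
          (univ : Finset ((⊤ : SimpleGraph (Fin m)).edgeSet))).image (fun M => fun e => decide (e ∉ M)))) := by
  intro h7 c
  obtain ⟨r₀, s₀, hr₀, hs₀, h⟩ := h7 c
  refine ⟨r₀, s₀, hr₀, hs₀, fun r s hr hs => ?_⟩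
  filter_upwards [h r s hr hs] with m hm φ hφ
  intro hn D C hA _hD hC hDC
  exact pairGoal_of_cnfGoal φ hφ.monotone _ _ hDC (hm φ hφ hn C ((card_image_cnf_le D C).trans hA) hC)

open Classical in
/-- **CONV (REGISTERED `convWidePairText_of_cnfText`)**: the CNF-side r7 text `stub_convWideCnf` implies the r6
text `stub_convWide` verbatim; in particular it inherits the calibration p121086 (no single SDP-feasibility
gate of width `m^c` computes `CLIQUE(m, ⌈m^{1/4}⌉₊)`). [folklore] -/
theorem convWidePairText_of_cnfText :
    (∀ c : ℕ, ∃ r₀ s₀ : ℕ, 2 ≤ r₀ ∧ 2 ≤ s₀ ∧ ∀ r s : ℕ, r₀ ≤ r → s₀ ≤ s →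
    ∀ᶠ m : ℕ in atTop, ∀ φ : GateFn,
      (∃ p q : ℕ, p + q ≤ m ^ c ∧ ⌊(m : ℝ) ^ (1 / 16 : ℝ)⌋₊ < p ∧ c + 1 < q ∧
        ∃ (A : Fin p → Matrix (Fin q) (Fin q) ℝ) (b : Fin p → ℝ)
        (B : Fin p → Fin φ.1 → ℝ), (∀ i j, 0 ≤ B i j) ∧ ∀ v : Fin φ.1 → Bool, φ.2 v = true ↔
          ∃ Y : Matrix (Fin q) (Fin q) ℝ, Y.PosSemidef ∧
            ∀ i, (A i * Y).trace ≤ b i + ∑ j, B i j * (if v j then (1 : ℝ) else 0)) →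
      ∀ C : Fin φ.1 → Finset (Finset ((⊤ : SimpleGraph (Fin m)).edgeSet)),
        #(univ.image C) ≤ m ^ (c + 3) → (∀ j, ∀ S ∈ C j, #S ≤ s - 1) →
        ∃ dnf cnf : Finset (Finset ((⊤ : SimpleGraph (Fin m)).edgeSet)),
          (∀ R ∈ dnf, #R ≤ r - 1) ∧ (∀ S ∈ cnf, #S ≤ s - 1) ∧
          (∀ x, EvalDNF dnf x → EvalCNF cnf x) ∧
          (#((posGraphs m ⌈(m : ℝ) ^ (1 / 4 : ℝ)⌉₊).filter
              (fun x => φ.2 (fun j => decide (EvalCNF (C j) x)) = true ∧ ¬ EvalDNF dnf x)) : ℝ)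
            ≤ (1 / (8 * (m : ℝ) ^ (c + 1))) * #(posGraphs m ⌈(m : ℝ) ^ (1 / 4 : ℝ)⌉₊) ∧
          (#((((powersetCard (Fintype.card ((⊤ : SimpleGraph (Fin m)).edgeSet) / ⌊(m : ℝ) ^ (1 / 8 : ℝ)⌋₊)
          (univ : Finset ((⊤ : SimpleGraph (Fin m)).edgeSet))).image (fun M => fun e => decide (e ∉ M)))).filter
              (fun x => EvalCNF cnf x ∧ φ.2 (fun j => decide (EvalCNF (C j) x)) = false)) : ℝ)
            ≤ (1 / (8 * (m : ℝ) ^ (c + 1))) *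
              #(((powersetCard (Fintype.card ((⊤ : SimpleGraph (Fin m)).edgeSet) / ⌊(m : ℝ) ^ (1 / 8 : ℝ)⌋₊)
          (univ : Finset ((⊤ : SimpleGraph (Fin m)).edgeSet))).image (fun M => fun e => decide (e ∉ M))))) →
    ∀ c : ℕ, ∃ r₀ s₀ : ℕ, 2 ≤ r₀ ∧ 2 ≤ s₀ ∧ ∀ r s : ℕ, r₀ ≤ r → s₀ ≤ s →
    ∀ᶠ m : ℕ in atTop, ∀ φ : GateFn,
      (∃ p q : ℕ, p + q ≤ m ^ c ∧ ⌊(m : ℝ) ^ (1 / 16 : ℝ)⌋₊ < p ∧ c + 1 < q ∧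
        ∃ (A : Fin p → Matrix (Fin q) (Fin q) ℝ) (b : Fin p → ℝ)
        (B : Fin p → Fin φ.1 → ℝ), (∀ i j, 0 ≤ B i j) ∧ ∀ v : Fin φ.1 → Bool, φ.2 v = true ↔
          ∃ Y : Matrix (Fin q) (Fin q) ℝ, Y.PosSemidef ∧
            ∀ i, (A i * Y).trace ≤ b i + ∑ j, B i j * (if v j then (1 : ℝ) else 0)) →
      ∀ (D C : Fin φ.1 → Finset (Finset ((⊤ : SimpleGraph (Fin m)).edgeSet))),
        #(univ.image fun j => (D j, C j)) ≤ m ^ (c + 3) →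
        (∀ j, ∀ R ∈ D j, #R ≤ r - 1) → (∀ j, ∀ S ∈ C j, #S ≤ s - 1) →
        (∀ j x, EvalDNF (D j) x → EvalCNF (C j) x) →
        ∃ dnf cnf : Finset (Finset ((⊤ : SimpleGraph (Fin m)).edgeSet)),
          (∀ R ∈ dnf, #R ≤ r - 1) ∧ (∀ S ∈ cnf, #S ≤ s - 1) ∧
          (∀ x, EvalDNF dnf x → EvalCNF cnf x) ∧
          (#((posGraphs m ⌈(m : ℝ) ^ (1 / 4 : ℝ)⌉₊).filter
              (fun x => φ.2 (fun j => decide (EvalDNF (D j) x)) = true ∧ ¬ EvalDNF dnf x)) : ℝ)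
            ≤ (1 / (8 * (m : ℝ) ^ (c + 1))) * #(posGraphs m ⌈(m : ℝ) ^ (1 / 4 : ℝ)⌉₊) ∧
          (#((((powersetCard (Fintype.card ((⊤ : SimpleGraph (Fin m)).edgeSet) / ⌊(m : ℝ) ^ (1 / 8 : ℝ)⌋₊)
          (univ : Finset ((⊤ : SimpleGraph (Fin m)).edgeSet))).image (fun M => fun e => decide (e ∉ M)))).filter
              (fun x => EvalCNF cnf x ∧ φ.2 (fun j => decide (EvalCNF (C j) x)) = false)) : ℝ)
            ≤ (1 / (8 * (m : ℝ) ^ (c + 1))) *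
              #(((powersetCard (Fintype.card ((⊤ : SimpleGraph (Fin m)).edgeSet) / ⌊(m : ℝ) ^ (1 / 8 : ℝ)⌋₊)
          (univ : Finset ((⊤ : SimpleGraph (Fin m)).edgeSet))).image (fun M => fun e => decide (e ∉ M)))) := by
  intro h7 c
  obtain ⟨r₀, s₀, hr₀, hs₀, h⟩ := h7 c
  refine ⟨r₀, s₀, hr₀, hs₀, fun r s hr hs => ?_⟩
  filter_upwards [h r s hr hs] with m hm φ hφ
  intro D C hA _hD hC hDC
  have hmono : Monotone φ.2 := by
    obtain ⟨p, q, hpq, -, -, A, b, B, hB, hrep⟩ := hφ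
    exact IsConvGate.monotone ⟨p, q, hpq, A, b, B, hB, hrep⟩
  exact pairGoal_of_cnfGoal φ hmono _ _ hDC (hm φ hφ C ((card_image_cnf_le D C).trans hA) hC)

open Classical in
/-- **THE r7 BRIDGE (REGISTERED `cliqueExtLowerBound_of_three_r7`)**: the crux from the three CNF-side stub
texts `stub_permCnf`, `stub_grankCnf`, `stub_convWideCnf` of skeleton r7 — everything else of the line is
landed (r6 bridge `ConvCalibrationR6.cliqueExtLowerBound_of_three_r6`, p121086). [cite: Jukna2012, Thm. 9.21] -/
theorem cliqueExtLowerBound_of_three_r7 :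
    (∀ c : ℕ, ∃ r₀ s₀ : ℕ, 2 ≤ r₀ ∧ 2 ≤ s₀ ∧ ∀ r s : ℕ, r₀ ≤ r → s₀ ≤ s →
    ∀ᶠ m : ℕ in atTop, ∀ φ : GateFn, IsPermGate (m ^ c) φ →
      ¬ (IsPermGate ⌊(m : ℝ) ^ (1 / 16 : ℝ)⌋₊ φ ∨ IsGRankGate ⌊(m : ℝ) ^ (1 / 16 : ℝ)⌋₊ φ) →
      ∀ C : Fin φ.1 → Finset (Finset ((⊤ : SimpleGraph (Fin m)).edgeSet)),
        #(univ.image C) ≤ m ^ (c + 3) → (∀ j, ∀ S ∈ C j, #S ≤ s - 1) →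
        ∃ dnf cnf : Finset (Finset ((⊤ : SimpleGraph (Fin m)).edgeSet)),
          (∀ R ∈ dnf, #R ≤ r - 1) ∧ (∀ S ∈ cnf, #S ≤ s - 1) ∧
          (∀ x, EvalDNF dnf x → EvalCNF cnf x) ∧
          (#((posGraphs m ⌈(m : ℝ) ^ (1 / 4 : ℝ)⌉₊).filter
              (fun x => φ.2 (fun j => decide (EvalCNF (C j) x)) = true ∧ ¬ EvalDNF dnf x)) : ℝ)
            ≤ (1 / (8 * (m : ℝ) ^ (c + 1))) * #(posGraphs m ⌈(m : ℝ) ^ (1 / 4 : ℝ)⌉₊) ∧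
          (#((((powersetCard (Fintype.card ((⊤ : SimpleGraph (Fin m)).edgeSet) / ⌊(m : ℝ) ^ (1 / 8 : ℝ)⌋₊)
          (univ : Finset ((⊤ : SimpleGraph (Fin m)).edgeSet))).image (fun M => fun e => decide (e ∉ M)))).filter
              (fun x => EvalCNF cnf x ∧ φ.2 (fun j => decide (EvalCNF (C j) x)) = false)) : ℝ)
            ≤ (1 / (8 * (m : ℝ) ^ (c + 1))) *
              #(((powersetCard (Fintype.card ((⊤ : SimpleGraph (Fin m)).edgeSet) / ⌊(m : ℝ) ^ (1 / 8 : ℝ)⌋₊)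
          (univ : Finset ((⊤ : SimpleGraph (Fin m)).edgeSet))).image (fun M => fun e => decide (e ∉ M))))) →
    (∀ c : ℕ, ∃ r₀ s₀ : ℕ, 2 ≤ r₀ ∧ 2 ≤ s₀ ∧ ∀ r s : ℕ, r₀ ≤ r → s₀ ≤ s →
    ∀ᶠ m : ℕ in atTop, ∀ φ : GateFn, IsGRankGate (m ^ c) φ →
      ¬ (IsPermGate ⌊(m : ℝ) ^ (1 / 16 : ℝ)⌋₊ φ ∨ IsGRankGate ⌊(m : ℝ) ^ (1 / 16 : ℝ)⌋₊ φ) →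
      ∀ C : Fin φ.1 → Finset (Finset ((⊤ : SimpleGraph (Fin m)).edgeSet)),
        #(univ.image C) ≤ m ^ (c + 3) → (∀ j, ∀ S ∈ C j, #S ≤ s - 1) →
        ∃ dnf cnf : Finset (Finset ((⊤ : SimpleGraph (Fin m)).edgeSet)),
          (∀ R ∈ dnf, #R ≤ r - 1) ∧ (∀ S ∈ cnf, #S ≤ s - 1) ∧
          (∀ x, EvalDNF dnf x → EvalCNF cnf x) ∧
          (#((posGraphs m ⌈(m : ℝ) ^ (1 / 4 : ℝ)⌉₊).filter
              (fun x => φ.2 (fun j => decide (EvalCNF (C j) x)) = true ∧ ¬ EvalDNF dnf x)) : ℝ)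
            ≤ (1 / (8 * (m : ℝ) ^ (c + 1))) * #(posGraphs m ⌈(m : ℝ) ^ (1 / 4 : ℝ)⌉₊) ∧
          (#((((powersetCard (Fintype.card ((⊤ : SimpleGraph (Fin m)).edgeSet) / ⌊(m : ℝ) ^ (1 / 8 : ℝ)⌋₊)
          (univ : Finset ((⊤ : SimpleGraph (Fin m)).edgeSet))).image (fun M => fun e => decide (e ∉ M)))).filter
              (fun x => EvalCNF cnf x ∧ φ.2 (fun j => decide (EvalCNF (C j) x)) = false)) : ℝ)
            ≤ (1 / (8 * (m : ℝ) ^ (c + 1))) *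
              #(((powersetCard (Fintype.card ((⊤ : SimpleGraph (Fin m)).edgeSet) / ⌊(m : ℝ) ^ (1 / 8 : ℝ)⌋₊)
          (univ : Finset ((⊤ : SimpleGraph (Fin m)).edgeSet))).image (fun M => fun e => decide (e ∉ M))))) →
    (∀ c : ℕ, ∃ r₀ s₀ : ℕ, 2 ≤ r₀ ∧ 2 ≤ s₀ ∧ ∀ r s : ℕ, r₀ ≤ r → s₀ ≤ s →
    ∀ᶠ m : ℕ in atTop, ∀ φ : GateFn,
      (∃ p q : ℕ, p + q ≤ m ^ c ∧ ⌊(m : ℝ) ^ (1 / 16 : ℝ)⌋₊ < p ∧ c + 1 < q ∧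
        ∃ (A : Fin p → Matrix (Fin q) (Fin q) ℝ) (b : Fin p → ℝ)
        (B : Fin p → Fin φ.1 → ℝ), (∀ i j, 0 ≤ B i j) ∧ ∀ v : Fin φ.1 → Bool, φ.2 v = true ↔
          ∃ Y : Matrix (Fin q) (Fin q) ℝ, Y.PosSemidef ∧
            ∀ i, (A i * Y).trace ≤ b i + ∑ j, B i j * (if v j then (1 : ℝ) else 0)) →
      ∀ C : Fin φ.1 → Finset (Finset ((⊤ : SimpleGraph (Fin m)).edgeSet)),
        #(univ.image C) ≤ m ^ (c + 3) → (∀ j, ∀ S ∈ C j, #S ≤ s - 1) →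
        ∃ dnf cnf : Finset (Finset ((⊤ : SimpleGraph (Fin m)).edgeSet)),
          (∀ R ∈ dnf, #R ≤ r - 1) ∧ (∀ S ∈ cnf, #S ≤ s - 1) ∧
          (∀ x, EvalDNF dnf x → EvalCNF cnf x) ∧
          (#((posGraphs m ⌈(m : ℝ) ^ (1 / 4 : ℝ)⌉₊).filter
              (fun x => φ.2 (fun j => decide (EvalCNF (C j) x)) = true ∧ ¬ EvalDNF dnf x)) : ℝ)
            ≤ (1 / (8 * (m : ℝ) ^ (c + 1))) * #(posGraphs m ⌈(m : ℝ) ^ (1 / 4 : ℝ)⌉₊) ∧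
          (#((((powersetCard (Fintype.card ((⊤ : SimpleGraph (Fin m)).edgeSet) / ⌊(m : ℝ) ^ (1 / 8 : ℝ)⌋₊)
          (univ : Finset ((⊤ : SimpleGraph (Fin m)).edgeSet))).image (fun M => fun e => decide (e ∉ M)))).filter
              (fun x => EvalCNF cnf x ∧ φ.2 (fun j => decide (EvalCNF (C j) x)) = false)) : ℝ)
            ≤ (1 / (8 * (m : ℝ) ^ (c + 1))) *
              #(((powersetCard (Fintype.card ((⊤ : SimpleGraph (Fin m)).edgeSet) / ⌊(m : ℝ) ^ (1 / 8 : ℝ)⌋₊)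
          (univ : Finset ((⊤ : SimpleGraph (Fin m)).edgeSet))).image (fun M => fun e => decide (e ∉ M))))) →
    Summit.PneNP.PneNP.Theses.ConvexRankGates.CliqueExtLowerBound :=
  fun hP hG hW => ConvCalibrationR6.cliqueExtLowerBound_of_three_r6 (permPairText_of_cnfText hP)
    (grankPairText_of_cnfText hG) (convWidePairText_of_cnfText hW)

end Summit.PneNP.PneNP.Theorems.CliqueExtLowerBound.WidthThreshold.CnfSide

end
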